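import Mathlib
import Summits.ValiantsHypothesis.ValiantsHypothesis.Theorems.NewtonUnitEquationsTwoProductsPlanarCellSingleRelation
import HarnessLib

/-!
# Crux `TwoProducts` (stmt-ValiantsHypothesis-5906): the single-relation law is `t`-FREE
# (one primitive relation class ⇒ per cell `#S ≤ 12·(m+1)⁵`, independently of the sparsity)

Helper mode (`--supports stmt-ValiantsHypothesis-5906 --as helper`; val-lit-p3 g14, KEEP lineage).  Sharpens rung R1 of
`Cruxes/TwoProducts/Lines/relation_ladder.lean` (landed by name as `singleRelationLaw`, exponent `(s+2)^3`): under ONE primitive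
relation class `(J, a₀, b₀)` the per-cell count of visible points is bounded by a polynomial in `m` ALONE
(`planarCell_singleRelation_tfree`), in contrast with the general cell, where NO `t`-free bound exists
(`…TwoProducts.Negative.not_planarSlotBound`, p600147: the `m = 2` staircase has `K+1` visible points in one cell — and `K(K+1)/2`
DISTINCT relation classes).  So the `t`-dependence of `PlanarCellBound` is carried by the NUMBER of relation classes, not by the
`(s+1)^{m−|J|}` translates of one class.

PROOF.  As in `planarCell_singleRelation` (merged families `≤ 2(m+1)` each by `card_merged_le`), but the LONE points are grouped by
the letter-free key `(κ_{a₀}(c), κ_{b₀}(c))`, `κ_x(c) := D_x(c) = {i ∈ J : c_i ≠ x_i}` if `#D_x(c) ≤ 2` and `:= J` (sentinel)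
otherwise: inside a key class every `≤ 2`-position upgrade `a'` of `c` by letters of class members stays lone — if `#D_x(c) ≥ 3` two
changed positions cannot reach `x|J` (`not_Jpart_of_far`); if `#D_x(c) ≤ 2` all class members have the SAME `D_x` and therefore avoid
the letters of `x` on it (`not_Jpart_of_keyEq`).  Hence each key class is a lone family (`card_lone_group_le`, `≤ 2(m+1)`), and there
are at most `(2 + m + C(m,2))²` keys.

Honest framing: a witness-rung sharpening outside the cone of an OPEN crux line; the residual, `PlanarCellBound`, the crux
`TwoProducts` and `VP ≠ VNP` are OPEN and NOT claimed; no summit statement is proved here.  No instances, no notation, no named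
facts. [folklore]
-/

noncomputable section

-- Sub = Summit single-conjunct layout: the duplicated namespace component is mandated by the tree.
set_option linter.dupNamespace false

open scoped BigOperators
open MvPolynomial
open Summit.ValiantsHypothesis.ValiantsHypothesis.Theorems.NewtonUnitEquations.TwoProducts.FormalLogLinearisation

namespace Summit.ValiantsHypothesis.ValiantsHypothesis.Theorems.NewtonUnitEquations.TwoProducts.PlanarCell

variable {m : ℕ}

/-! ## The letter-free key -/

/-- **Same key ⇒ upgrades stay away from `x|J`.**  Let `c|J ≠ x|J`, and let `c₁, c₂` have the same key
`κ_x := if #D_x ≤ 2 then D_x else J` as `c` (`D_x(c) = {i ∈ J : c_i ≠ x_i}`).  If `a'` takes its letters positionwise from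
`c, c₁, c₂` and agrees with `c` outside `{j, j'}`, then `a'|J ≠ x|J`. [folklore] -/
theorem not_Jpart_of_keyEq (J : Finset (Fin m)) (x c c₁ c₂ a' : Fin m → Expo) (j j' : Fin m)
    (hcx : ¬ ∀ i ∈ J, c i = x i)
    (hk₁ : (if (J.filter fun i => c₁ i ≠ x i).card ≤ 2 then (J.filter fun i => c₁ i ≠ x i) else J) =
      (if (J.filter fun i => c i ≠ x i).card ≤ 2 then (J.filter fun i => c i ≠ x i) else J))
    (hk₂ : (if (J.filter fun i => c₂ i ≠ x i).card ≤ 2 then (J.filter fun i => c₂ i ≠ x i) else J) =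
      (if (J.filter fun i => c i ≠ x i).card ≤ 2 then (J.filter fun i => c i ≠ x i) else J))
    (hletters : ∀ i, a' i = c i ∨ a' i = c₁ i ∨ a' i = c₂ i) (hagree : ∀ i, i ≠ j → i ≠ j' → a' i = c i) :
    ¬ ∀ i ∈ J, a' i = x i := by
  classical
  by_cases h3 : (J.filter fun i => c i ≠ x i).card ≤ 2
  · -- small difference set: the class members share it
    have hshare : ∀ c' : Fin m → Expo,
        (if (J.filter fun i => c' i ≠ x i).card ≤ 2 then (J.filter fun i => c' i ≠ x i) else J) =
          (if (J.filter fun i => c i ≠ x i).card ≤ 2 then (J.filter fun i => c i ≠ x i) else J) →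
        (J.filter fun i => c' i ≠ x i) = (J.filter fun i => c i ≠ x i) := by
      intro c' hk
      rw [if_pos h3] at hk
      by_cases h' : (J.filter fun i => c' i ≠ x i).card ≤ 2
      · rwa [if_pos h'] at hk
      · rw [if_neg h'] at hk
        exfalso
        apply h'
        have hsub : (J.filter fun i => c' i ≠ x i) ⊆ J := Finset.filter_subset _ _
        calc (J.filter fun i => c' i ≠ x i).card ≤ J.card := Finset.card_le_card hsub
          _ = (J.filter fun i => c i ≠ x i).card := by rw [← hk]
          _ ≤ 2 := h3
    have hD₁ := hshare c₁ hk₁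
    have hD₂ := hshare c₂ hk₂
    intro hall
    apply hcx
    intro i hi
    by_contra hne
    have hiD : i ∈ J.filter fun i => c i ≠ x i := Finset.mem_filter.2 ⟨hi, hne⟩
    have h1 : c₁ i ≠ x i := by
      have : i ∈ J.filter fun i => c₁ i ≠ x i := by rw [hD₁]; exact hiD
      exact (Finset.mem_filter.1 this).2
    have h2 : c₂ i ≠ x i := by
      have : i ∈ J.filter fun i => c₂ i ≠ x i := by rw [hD₂]; exact hiD
      exact (Finset.mem_filter.1 this).2
    have hax := hall i hi
    rcases hletters i with h | h | h <;> rw [h] at hax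
    · exact hne hax
    · exact h1 hax
    · exact h2 hax
  · -- large difference set: two changed positions cannot reach `x|J`
    exact not_Jpart_of_far J x c a' j j' (by omega) hagree

/-- The key set `{J} ∪ {D ⊆ J : #D ≤ 2}` has at most `2 + m + C(m,2)` elements. [folklore] -/
theorem card_JpartKeySet_le (J : Finset (Fin m)) :
    (insert J (J.powerset.filter fun D => D.card ≤ 2)).card ≤ 2 + m + m.choose 2 := by
  classical
  have hJ : J.card ≤ m := by simpa using Finset.card_le_univ J
  have hsub : (J.powerset.filter fun D => D.card ≤ 2) ⊆
      J.powersetCard 0 ∪ J.powersetCard 1 ∪ J.powersetCard 2 := by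
    intro D hD
    rw [Finset.mem_filter, Finset.mem_powerset] at hD
    simp only [Finset.mem_union, Finset.mem_powersetCard]
    rcases Nat.lt_or_ge D.card 1 with h | h
    · exact Or.inl (Or.inl ⟨hD.1, by omega⟩)
    · rcases Nat.lt_or_ge D.card 2 with h' | h'
      · exact Or.inl (Or.inr ⟨hD.1, by omega⟩)
      · exact Or.inr ⟨hD.1, by omega⟩
  have hcard : (J.powerset.filter fun D => D.card ≤ 2).card ≤ 1 + m + m.choose 2 := by
    calc (J.powerset.filter fun D => D.card ≤ 2).card
        ≤ (J.powersetCard 0 ∪ J.powersetCard 1 ∪ J.powersetCard 2).card := Finset.card_le_card hsub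
      _ ≤ (J.powersetCard 0 ∪ J.powersetCard 1).card + (J.powersetCard 2).card := Finset.card_union_le _ _
      _ ≤ (J.powersetCard 0).card + (J.powersetCard 1).card + (J.powersetCard 2).card :=
          Nat.add_le_add_right (Finset.card_union_le _ _) _
      _ = J.card.choose 0 + J.card.choose 1 + J.card.choose 2 := by
          rw [Finset.card_powersetCard, Finset.card_powersetCard, Finset.card_powersetCard]
      _ ≤ 1 + m + m.choose 2 := by
          rw [Nat.choose_zero_right, Nat.choose_one_right]
          exact Nat.add_le_add (Nat.add_le_add_left hJ 1) (Nat.choose_le_choose 2 hJ)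
  calc (insert J (J.powerset.filter fun D => D.card ≤ 2)).card
      ≤ (J.powerset.filter fun D => D.card ≤ 2).card + 1 := Finset.card_insert_le _ _
    _ ≤ (1 + m + m.choose 2) + 1 := Nat.add_le_add_right hcard 1
    _ = 2 + m + m.choose 2 := by ring

/-! ## The `t`-free single-relation cell bound -/

/-- **SINGLE RELATION ⇒ `t`-FREE PER-CELL BOUND.**  Tails in `A_j ∌ 0` (NO bound on `#A_j` is used), one primitive relation
class `(J, a₀, b₀)`; then every cell family has `#S ≤ 4(m+1) + 2(m+1)·(2 + m + C(m,2))²`. [folklore] -/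
theorem planarCell_singleRelation_tfree (u v : Fin m → MvPolynomial (Fin 2) ℂ) (A : Fin m → Finset Expo)
    (hA0 : ∀ j, (0 : Expo) ∉ A j)
    (huA : ∀ j, (u j).support ⊆ A j) (hvA : ∀ j, (v j).support ⊆ A j)
    (J : Finset (Fin m)) (a₀ b₀ : Fin m → Expo)
    (hSR : ∀ a ∈ tuples A, ∀ b ∈ tuples A, a ≠ b → ∑ j, a j = ∑ j, b j →
      (∀ j, a j ≠ b j ↔ j ∈ J) ∧ ((∀ j ∈ J, a j = a₀ j ∧ b j = b₀ j) ∨ (∀ j ∈ J, a j = b₀ j ∧ b j = a₀ j)))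
    (R : Expo → Expo → Prop) (S : Finset Expo) (hS : IsCellFamily u v R S) :
    S.card ≤ 4 * (m + 1) + 2 * (m + 1) * (2 + m + m.choose 2) ^ 2 := by
  classical
  set PF := tuples A with hPF
  set T := tailSupport u v with hT
  have hu0 : ∀ j, coeff 0 (u j) = 0 := fun j => notMem_support_iff.1 fun h => hA0 j (huA j h)
  have hv0 : ∀ j, coeff 0 (v j) = 0 := fun j => notMem_support_iff.1 fun h => hA0 j (hvA j h)
  rcases S.eq_empty_or_nonempty with hS0 | ⟨l₀, hl₀⟩
  · simp [hS0]
  obtain ⟨ζ, hζval, -, hRζ⟩ := hS l₀ hl₀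
  -- representations with `F ≠ G`
  have hrep : ∀ l ∈ S, ∃ a ∈ PF, ∑ j, a j = l ∧
      ∏ j, hatCoeff (u j) (a j) ≠ ∏ j, hatCoeff (v j) (a j) := by
    intro l hl
    obtain ⟨ξ, hval, htop, -⟩ := hS l hl
    have hmem : l ∈ (tailDiff u v).support := ((stub_logLinearisation m u v hu0 hv0 ξ hval l).2 htop).1
    have hne : coeff l (tailDiff u v) ≠ 0 := mem_support_iff.1 hmem
    have hW : tailDiff u v = ∏ j, (1 + u j) - ∏ j, (1 + v j) := rfl
    rw [hW, coeff_sub, coeff_prod_one_add_eq_fibreSum u A hA0 huA, coeff_prod_one_add_eq_fibreSum v A hA0 hvA,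
      ← Finset.sum_sub_distrib] at hne
    obtain ⟨a, ha, hne'⟩ := Finset.exists_ne_zero_of_sum_ne_zero hne
    rw [Finset.mem_filter] at ha
    exact ⟨a, ha.1, ha.2, fun h => hne' (sub_eq_zero.2 h)⟩
  choose! rep hrepPF hrepsum hrepne using hrep
  -- letters of representations are `0` or tail exponents
  have hT_of : ∀ (w : Fin m → MvPolynomial (Fin 2) ℂ) (i : Fin m) (e : Expo), (w = u ∨ w = v) →
      hatCoeff (w i) e ≠ 0 → e = 0 ∨ e ∈ T := by
    intro w i e hw hne
    by_cases he : e = 0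
    · exact Or.inl he
    · right
      simp only [hatCoeff, he, if_false] at hne
      have hmem : e ∈ (w i).support := mem_support_iff.2 hne
      rcases hw with rfl | rfl
      · exact Finset.mem_union_left _ (Finset.mem_biUnion.2 ⟨i, Finset.mem_univ _, hmem⟩)
      · exact Finset.mem_union_right _ (Finset.mem_biUnion.2 ⟨i, Finset.mem_univ _, hmem⟩)
  have hrepT : ∀ l ∈ S, ∀ i, rep l i = 0 ∨ rep l i ∈ T := by
    intro l hl i
    by_cases hF : ∏ j, hatCoeff (u j) (rep l j) = 0
    · have hG : ∏ j, hatCoeff (v j) (rep l j) ≠ 0 := fun hG => hrepne l hl (by rw [hF, hG])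
      exact hT_of v i _ (Or.inr rfl) (Finset.prod_ne_zero_iff.1 hG i (Finset.mem_univ _))
    · exact hT_of u i _ (Or.inl rfl) (Finset.prod_ne_zero_iff.1 hF i (Finset.mem_univ _))
  -- shapes of upgrades
  have hshape : ∀ (l l₁ l₂ : Expo) (j j' : Fin m) (a' : Fin m → Expo),
      (a' = Function.update (rep l) j (rep l₁ j) ∨ a' = Function.update (rep l) j' (rep l₂ j') ∨
          a' = Function.update (Function.update (rep l) j (rep l₁ j)) j' (rep l₂ j')) →
      (∀ i, a' i = rep l i ∨ a' i = rep l₁ i ∨ a' i = rep l₂ i) ∧ (∀ i, i ≠ j → i ≠ j' → a' i = rep l i) := by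
    intro l l₁ l₂ j j' a' ha'
    rcases ha' with rfl | rfl | rfl
    · refine ⟨fun i => ?_, fun i hij _ => by rw [Function.update_of_ne hij]⟩
      by_cases hi : i = j
      · subst hi; rw [Function.update_self]; exact Or.inr (Or.inl rfl)
      · rw [Function.update_of_ne hi]; exact Or.inl rfl
    · refine ⟨fun i => ?_, fun i _ hij' => by rw [Function.update_of_ne hij']⟩
      by_cases hi : i = j'
      · subst hi; rw [Function.update_self]; exact Or.inr (Or.inr rfl)
      · rw [Function.update_of_ne hi]; exact Or.inl rfl
    · refine ⟨fun i => ?_, fun i hij hij' => by rw [Function.update_of_ne hij', Function.update_of_ne hij]⟩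
      by_cases hi : i = j'
      · subst hi; rw [Function.update_self]; exact Or.inr (Or.inr rfl)
      · rw [Function.update_of_ne hi]
        by_cases hi2 : i = j
        · subst hi2; rw [Function.update_self]; exact Or.inr (Or.inl rfl)
        · rw [Function.update_of_ne hi2]; exact Or.inl rfl
  have hshapePF : ∀ l ∈ S, ∀ l₁ ∈ S, ∀ l₂ ∈ S, ∀ (j j' : Fin m) (a' : Fin m → Expo),
      (a' = Function.update (rep l) j (rep l₁ j) ∨ a' = Function.update (rep l) j' (rep l₂ j') ∨
          a' = Function.update (Function.update (rep l) j (rep l₁ j)) j' (rep l₂ j')) → a' ∈ PF := by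
    intro l hl l₁ hl₁ l₂ hl₂ j j' a' ha'
    have m0 := Fintype.mem_piFinset.1 (hrepPF l hl)
    have m1 := Fintype.mem_piFinset.1 (hrepPF l₁ hl₁)
    have m2 := Fintype.mem_piFinset.1 (hrepPF l₂ hl₂)
    refine Fintype.mem_piFinset.2 fun i => ?_
    rcases (hshape l l₁ l₂ j j' a' ha').1 i with h | h | h <;> rw [h]
    · exact m0 i
    · exact m1 i
    · exact m2 i
  -- the three families
  set Sa := S.filter fun l => ∀ i ∈ J, rep l i = a₀ i with hSa
  set Sb := S.filter fun l => ∀ i ∈ J, rep l i = b₀ i with hSb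
  set Slone := S.filter fun l => ¬ (∀ i ∈ J, rep l i = a₀ i) ∧ ¬ (∀ i ∈ J, rep l i = b₀ i) with hSlone
  have hcover : S ⊆ Sa ∪ Sb ∪ Slone := by
    intro l hl
    simp only [Finset.mem_union]
    by_cases ha : ∀ i ∈ J, rep l i = a₀ i
    · exact Or.inl (Or.inl (Finset.mem_filter.2 ⟨hl, ha⟩))
    by_cases hb : ∀ i ∈ J, rep l i = b₀ i
    · exact Or.inl (Or.inr (Finset.mem_filter.2 ⟨hl, hb⟩))
    · exact Or.inr (Finset.mem_filter.2 ⟨hl, ha, hb⟩)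
  -- merged families
  have hSacard : Sa.card ≤ 2 * (m + 1) :=
    card_merged_le u v A hA0 huA hvA J a₀ b₀ hSR R S hS ζ hζval hRζ rep hrepPF hrepsum hrepT
  have hSR' : ∀ a ∈ tuples A, ∀ b ∈ tuples A, a ≠ b → ∑ j, a j = ∑ j, b j →
      (∀ j, a j ≠ b j ↔ j ∈ J) ∧ ((∀ j ∈ J, a j = b₀ j ∧ b j = a₀ j) ∨ (∀ j ∈ J, a j = a₀ j ∧ b j = b₀ j)) :=
    fun a ha b hb hne hsum => ⟨(hSR a ha b hb hne hsum).1, (hSR a ha b hb hne hsum).2.symm⟩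
  have hSbcard : Sb.card ≤ 2 * (m + 1) :=
    card_merged_le u v A hA0 huA hvA J b₀ a₀ hSR' R S hS ζ hζval hRζ rep hrepPF hrepsum hrepT
  -- the lone family, grouped by the letter-free key
  let kap : (Fin m → Expo) → (Fin m → Expo) → Finset (Fin m) := fun x c =>
    if (J.filter fun i => c i ≠ x i).card ≤ 2 then (J.filter fun i => c i ≠ x i) else J
  let key : Expo → Finset (Fin m) × Finset (Fin m) := fun l => (kap a₀ (rep l), kap b₀ (rep l))
  have hgroup : ∀ K : Finset (Fin m) × Finset (Fin m), (Slone.filter fun l => key l = K).card ≤ 2 * (m + 1) := by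
    intro K
    refine card_lone_group_le u v A hA0 huA hvA R S hS ζ hζval hRζ rep hrepPF hrepsum (Slone.filter fun l => key l = K)
      (fun l hl => (Finset.mem_filter.1 (Finset.mem_filter.1 hl).1).1)
      (fun l hl => hrepne l (Finset.mem_filter.1 (Finset.mem_filter.1 hl).1).1) ?_
    intro l hl l₁ hl₁ l₂ hl₂ j j' a' ha' b hb hsum
    have hl' := Finset.mem_filter.1 hl
    have hl₁' := Finset.mem_filter.1 hl₁
    have hl₂' := Finset.mem_filter.1 hl₂
    have hlS := (Finset.mem_filter.1 hl'.1).1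
    have hlone := (Finset.mem_filter.1 hl'.1).2
    have hk₁ : key l₁ = key l := hl₁'.2.trans hl'.2.symm
    have hk₂ : key l₂ = key l := hl₂'.2.trans hl'.2.symm
    have hsh := hshape l l₁ l₂ j j' a' ha'
    refine eq_of_lone A J a₀ b₀ hSR
      (hshapePF l hlS l₁ (Finset.mem_filter.1 hl₁'.1).1 l₂ (Finset.mem_filter.1 hl₂'.1).1 j j' a' ha') ?_ ?_ hb hsum
    · exact not_Jpart_of_keyEq J a₀ (rep l) (rep l₁) (rep l₂) a' j j' hlone.1
        (congrArg Prod.fst hk₁) (congrArg Prod.fst hk₂) hsh.1 hsh.2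
    · exact not_Jpart_of_keyEq J b₀ (rep l) (rep l₁) (rep l₂) a' j j' hlone.2
        (congrArg Prod.snd hk₁) (congrArg Prod.snd hk₂) hsh.1 hsh.2
  -- the keys
  set Keys := insert J (J.powerset.filter fun D => D.card ≤ 2) with hKeys
  have hkap : ∀ (x c : Fin m → Expo), kap x c ∈ Keys := by
    intro x c
    simp only [kap]
    split_ifs with h
    · exact Finset.mem_insert_of_mem (Finset.mem_filter.2 ⟨Finset.mem_powerset.2 (Finset.filter_subset _ _), h⟩)
    · exact Finset.mem_insert_self _ _
  have himage : Slone.image key ⊆ Keys ×ˢ Keys := by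
    intro K hK
    obtain ⟨l, -, rfl⟩ := Finset.mem_image.1 hK
    exact Finset.mem_product.2 ⟨hkap a₀ (rep l), hkap b₀ (rep l)⟩
  have hKeyscard : Keys.card ≤ 2 + m + m.choose 2 := card_JpartKeySet_le J
  have hSlonecard : Slone.card ≤ (2 + m + m.choose 2) ^ 2 * (2 * (m + 1)) := by
    calc Slone.card = ∑ K ∈ Slone.image key, (Slone.filter fun l => key l = K).card :=
          Finset.card_eq_sum_card_image key Slone
      _ ≤ ∑ _K ∈ Slone.image key, 2 * (m + 1) := Finset.sum_le_sum fun K _ => hgroup K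
      _ = (Slone.image key).card * (2 * (m + 1)) := by rw [Finset.sum_const, smul_eq_mul]
      _ ≤ (Keys ×ˢ Keys).card * (2 * (m + 1)) := Nat.mul_le_mul_right _ (Finset.card_le_card himage)
      _ = Keys.card * Keys.card * (2 * (m + 1)) := by rw [Finset.card_product]
      _ ≤ (2 + m + m.choose 2) * (2 + m + m.choose 2) * (2 * (m + 1)) :=
          Nat.mul_le_mul_right _ (Nat.mul_le_mul hKeyscard hKeyscard)
      _ = (2 + m + m.choose 2) ^ 2 * (2 * (m + 1)) := by ring
  calc S.card ≤ (Sa ∪ Sb ∪ Slone).card := Finset.card_le_card hcover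
    _ ≤ Sa.card + Sb.card + Slone.card := by
        refine (Finset.card_union_le _ _).trans (Nat.add_le_add_right ?_ _)
        exact Finset.card_union_le _ _
    _ ≤ 2 * (m + 1) + 2 * (m + 1) + (2 + m + m.choose 2) ^ 2 * (2 * (m + 1)) :=
        Nat.add_le_add (Nat.add_le_add hSacard hSbcard) hSlonecard
    _ = 4 * (m + 1) + 2 * (m + 1) * (2 + m + m.choose 2) ^ 2 := by ring

/-- Closing arithmetic: `4(m+1) + 2(m+1)(2 + m + C(m,2))² ≤ 12(m+1)⁵`. [folklore] -/
theorem singleRelation_tfree_arith (m : ℕ) :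
    4 * (m + 1) + 2 * (m + 1) * (2 + m + m.choose 2) ^ 2 ≤ 12 * (m + 1) ^ 5 := by
  have hc : m.choose 2 ≤ m * m := by
    rw [Nat.choose_two_right]
    exact (Nat.div_le_self _ _).trans (Nat.mul_le_mul_left m (Nat.sub_le m 1))
  have h1 : 2 + m + m.choose 2 ≤ 2 * (m + 1) ^ 2 := by nlinarith
  have h2 : (2 + m + m.choose 2) ^ 2 ≤ (2 * (m + 1) ^ 2) ^ 2 := Nat.pow_le_pow_left h1 2
  have h3 : 1 ≤ (m + 1) ^ 4 := Nat.one_le_iff_ne_zero.2 (by positivity)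
  calc 4 * (m + 1) + 2 * (m + 1) * (2 + m + m.choose 2) ^ 2
      ≤ 4 * (m + 1) * (m + 1) ^ 4 + 2 * (m + 1) * (2 * (m + 1) ^ 2) ^ 2 := by
        have := Nat.mul_le_mul_left (4 * (m + 1)) h3
        have := Nat.mul_le_mul_left (2 * (m + 1)) h2
        nlinarith
    _ = 12 * (m + 1) ^ 5 := by ring

/-- **THE `t`-FREE SINGLE-RELATION LAW.**  Same hypotheses as the line's `SingleRelationLaw` (the sparsity bound `#A_j ≤ s` is not
even needed): one primitive relation class ⇒ every cell family has `#S ≤ 12·(m+1)⁵`. [folklore] -/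
theorem singleRelationLaw_tfree (u v : Fin m → MvPolynomial (Fin 2) ℂ) (A : Fin m → Finset Expo)
    (hA0 : ∀ j, (0 : Expo) ∉ A j) (huA : ∀ j, (u j).support ⊆ A j) (hvA : ∀ j, (v j).support ⊆ A j)
    (hrel : ∃ J : Finset (Fin m), ∃ a₀ b₀ : Fin m → Expo, ∀ a ∈ tuples A, ∀ b ∈ tuples A, a ≠ b → ∑ j, a j = ∑ j, b j →
      (∀ j, a j ≠ b j ↔ j ∈ J) ∧ ((∀ j ∈ J, a j = a₀ j ∧ b j = b₀ j) ∨ (∀ j ∈ J, a j = b₀ j ∧ b j = a₀ j)))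
    (R : Expo → Expo → Prop) (S : Finset Expo) (hS : IsCellFamily u v R S) :
    S.card ≤ 12 * (m + 1) ^ 5 := by
  obtain ⟨J, a₀, b₀, hSR⟩ := hrel
  exact (planarCell_singleRelation_tfree u v A hA0 huA hvA J a₀ b₀ hSR R S hS).trans (singleRelation_tfree_arith m)

end Summit.ValiantsHypothesis.ValiantsHypothesis.Theorems.NewtonUnitEquations.TwoProducts.PlanarCell

end
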